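import Literature.NumberTheory.Sieve.FordMaynardFibreIntegral
import Literature.NumberTheory.Sieve.FordMaynardFragmentationStructure
import HarnessLib

/-!
# Ford–Maynard: extensions by the fragmentation relation are piecewise Lipschitz (discharge)

Discharge of the named fact `FordMaynardFragmentationPiecewiseLipschitz` of
`Literature/NumberTheory/Sieve/FordMaynardFragmentation.lean`: for data `g` piecewise Lipschitz on
convex polytopes in every dimension (Definition 6.2 (b)), every restriction of the
(fsl)-extension `fragOp γ η g` is again piecewise Lipschitz. Everything here is PROVED, by
assembling the tree's analysis: the integrand of (6.3) is `PolyLip` in all variables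
(`polyLip_fragIntegrand`) with bounded support (`fragIntegrand_support`), fibre integrals of such
functions are piecewise Lipschitz (`PolyLip.isPiecewiseLipschitz'_integral`), and the class is
stable under finite sums and under multiplication by `ξ ↦ ∏ ξⱼ`.

## References

* K. Ford, J. Maynard, *On the theory of prime producing sieves*, arXiv:2407.14368v1 (2024), §6.2
  (proof of Theorem 6.3: "`h ∈ 𝔉_η`") and §9 (proof of Theorem 9.1: "`f̃ ∈ 𝔉_η(P)`").
  [FordMaynard2024PrimeSieves]
-/

noncomputable section

open MeasureTheory Finset

namespace Literature.NumberTheory.Sieve.FordMaynard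

/-- `ξ ↦ ∏ⱼ ξⱼ` is Lipschitz and bounded on every bounded subset of `ℝ^m`. [folklore] -/
theorem prod_coord_lipschitz_bounded (m : ℕ) (S : Set (Fin m → ℝ)) (hS : Bornology.IsBounded S) :
    (∃ K, LipschitzOnWith K (fun ξ : Fin m → ℝ => ∏ j, ξ j) S) ∧
      ∃ M, ∀ ξ ∈ S, |∏ j, ξ j| ≤ M := by
  obtain ⟨R, -, hR⟩ := exists_abs_le_of_isBounded hS
  refine lipschitzOnWith_prod_of_bounded (Finset.univ : Finset (Fin m)) fun j _ => ⟨⟨1, ?_⟩, ⟨R, fun ξ hξ => hR ξ hξ j⟩⟩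
  exact LipschitzWith.lipschitzOnWith (LipschitzWith.eval j)

/-- **Discharge of `FordMaynardFragmentationPiecewiseLipschitz`**: for `0 < γ < 1`, `0 < η` and
data `g` with every `g|ℝ^k` piecewise Lipschitz on convex polytopes, every restriction
`(fragOp γ η g)|ℝ^m` is piecewise Lipschitz on convex polytopes.
[cite: FordMaynard2024PrimeSieves, §6.2 (proof of Theorem 6.3 (a)) and §9 (proof of Theorem 9.1)] -/
theorem FordMaynardFragmentationPiecewiseLipschitz_holds : FordMaynardFragmentationPiecewiseLipschitz := by
  intro γ η _ _ hη g hg m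
  classical
  set N := maxBlock η with hN
  -- each term of (6.3) is a fibre integral of a `PolyLip` function with bounded support
  have hterm : ∀ kv ∈ Fintype.piFinset (fun _ : Fin m => Finset.Icc 1 N),
      IsPiecewiseLipschitz' (fun ξ : Fin m → ℝ => ∫ U : Fin m × Fin N → ℝ, fragIntegrand γ η N g kv ξ U) := by
    intro kv hkv
    rw [Fintype.mem_piFinset] at hkv
    have hkv1 : ∀ j, 1 ≤ kv j := fun j => (Finset.mem_Icc.1 (hkv j)).1
    have hkvN : ∀ j, kv j ≤ N := fun j => (Finset.mem_Icc.1 (hkv j)).2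
    have hPL : PolyLip (fun p : (Fin m → ℝ) × (Fin m × Fin N → ℝ) => fragIntegrand γ η N g kv p.1 p.2) :=
      polyLip_fragIntegrand γ hη N kv (hg _).isPiecewiseLipschitz'.polyLip
    obtain ⟨R, hR0, hR⟩ := (hg (∑ j, kv j)).exists_abs_le
    have hsupp := fun ξ U h => fragIntegrand_support (γ := γ) (η := η) hR0 hkv1 hkvN hR ξ U h
    have hD : IsPolyhedral {ξ : Fin m → ℝ | ∀ j, |ξ j| ≤ N * R} := isPolyhedral_absBox _
    have hDb : Bornology.IsBounded {ξ : Fin m → ℝ | ∀ j, |ξ j| ≤ N * R} := by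
      rw [absBox_eq_Icc]; exact Metric.isBounded_Icc _ _
    exact hPL.isPiecewiseLipschitz'_integral hD hDb (R := max R 1) fun ξ U h => hsupp ξ U h
  have hsum : IsPiecewiseLipschitz' (fun ξ : Fin m → ℝ =>
      ∑ kv ∈ Fintype.piFinset (fun _ : Fin m => Finset.Icc 1 N),
        ∫ U : Fin m × Fin N → ℝ, fragIntegrand γ η N g kv ξ U) :=
    IsPiecewiseLipschitz'.finset_sum _ hterm
  have hmul := hsum.mul_left (fun ξ : Fin m → ℝ => ∏ j, ξ j) (prod_coord_lipschitz_bounded m)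
  exact hmul.isPiecewiseLipschitz

end Literature.NumberTheory.Sieve.FordMaynard
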